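import Mathlib

/-!
# Route `FilamentSkeletonRss` · crux `SkeletonJ1R` (stmt-NavierStokesRegularity-23610) · registered line `streamline_kantorovich_R`
# — brick F(i)-g for stub F1 `LiaFrameExistsL`: SMOOTH GLOBAL INVERSE of a `C^n` function `ℝ → ℝ` with derivative bounded below

Lead `ns-fsr-lead-23610` (g0), `--supports stmt-NavierStokesRegularity-23610 --as helper`; pure Mathlib, route-independent.

WHY.  The datum-sliced model of the reshaped frame (`SkeletonJ1RFrame.SlicedModel`, FrameDefs §5) is built from the AXIAL RETRACTION
`h_j = (a_j ∘ x_j)⁻¹ ∘ a_j` of a near-straight reference `x_j`, where `a_j(y) = ⟪y − x_j 0, t_j⟫` is linear and `g_j = a_j ∘ x_j : ℝ → ℝ` has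
`g_j′ = ⟪x_j′, t_j⟫ ≥ 1 − ½(Rb/8)² > 0`.  This file supplies the one analytic ingredient: a `C^n` function `g : ℝ → ℝ` (`1 ≤ n`) with
`deriv g ≥ c > 0` everywhere is a `C^n` diffeomorphism of `ℝ` — `exists_contDiff_inverse_of_deriv_ge`: there is `G : ℝ → ℝ`, `C^n`, with
`G (g τ) = τ`, `g (G s) = s`, and `|G s − G s'| ≤ |s − s'|/c`.  (Strict monotonicity + `g τ − g 0 ≥ cτ` give a surjective order isomorphism, hence a
homeomorphism; `Homeomorph.contDiffAt_symm` with the invertible derivative `deriv g τ ≠ 0` gives smoothness of the inverse.)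

HONEST FRAMING.  Calculus bookkeeping for the ∃-side of a HYPOTHETICAL filament-type rotating-self-similar blow-up skeleton (MODEL rung, negative
side); nothing here is a claim about Navier–Stokes regularity or blow-up; stub F1 and the crux stay OPEN.
-/

set_option linter.dupNamespace false -- `NavierStokesRegularity.NavierStokesRegularity` path/namespace repetition is the tree convention

noncomputable section

namespace Summit.NavierStokesRegularity.NavierStokesRegularity.Theorems.SkeletonJ1RFrame

open Set Function Filter Real Topology

/-- Lower growth of a differentiable function with `deriv g ≥ c`: `c (b − a) ≤ g b − g a` for `a ≤ b`. [folklore] -/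
theorem mul_sub_le_sub_of_deriv_ge {g : ℝ → ℝ} (hg : Differentiable ℝ g) {c : ℝ} (hc : ∀ τ, c ≤ deriv g τ) {a b : ℝ} (hab : a ≤ b) :
    c * (b - a) ≤ g b - g a := by
  have hd : ∀ τ, HasDerivAt (fun τ => g τ - τ * c) (deriv g τ - c) τ := fun τ =>
    (hg τ).hasDerivAt.sub (hasDerivAt_mul_const c)
  have hmono : Monotone fun τ => g τ - τ * c :=
    monotone_of_deriv_nonneg (fun τ => (hd τ).differentiableAt) fun τ => by rw [(hd τ).deriv]; linarith [hc τ]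
  have := hmono hab
  simp only at this
  linarith

/-- **Smooth global inverse.**  A `C^n` function `g : ℝ → ℝ` (`1 ≤ n`) with `deriv g ≥ c > 0` everywhere has a `C^n` two-sided inverse `G`,
which is `c⁻¹`-Lipschitz. [folklore] -/
theorem exists_contDiff_inverse_of_deriv_ge {g : ℝ → ℝ} {n : WithTop ℕ∞} (hg : ContDiff ℝ n g) (hn : 1 ≤ n) {c : ℝ} (hc : 0 < c)
    (hgc : ∀ τ, c ≤ deriv g τ) :
    ∃ G : ℝ → ℝ, ContDiff ℝ n G ∧ (∀ τ, G (g τ) = τ) ∧ (∀ s, g (G s) = s) ∧ ∀ s s', |G s - G s'| ≤ |s - s'| / c := by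
  have hgd : Differentiable ℝ g := hg.differentiable (zero_lt_one.trans_le hn).ne'
  have hgcont : Continuous g := hgd.continuous
  -- strict monotonicity
  have hsm : StrictMono g := by
    intro a b hab
    have h := mul_sub_le_sub_of_deriv_ge hgd hgc hab.le
    have : 0 < c * (b - a) := mul_pos hc (by linarith)
    linarith
  -- surjectivity from linear growth
  have hlin_top : Tendsto (fun τ : ℝ => g 0 + c * τ) atTop atTop :=
    tendsto_atTop_add_const_left _ _ (tendsto_id.const_mul_atTop hc)
  have hlin_bot : Tendsto (fun τ : ℝ => g 0 + c * τ) atBot atBot :=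
    tendsto_atBot_add_const_left _ _ (tendsto_id.const_mul_atBot hc)
  have htop : Tendsto g atTop atTop := by
    refine tendsto_atTop_mono' atTop ?_ hlin_top
    filter_upwards [eventually_ge_atTop (0:ℝ)] with τ hτ
    have := mul_sub_le_sub_of_deriv_ge hgd hgc hτ
    simp only [sub_zero] at this; linarith
  have hbot : Tendsto g atBot atBot := by
    refine tendsto_atBot_mono' atBot ?_ hlin_bot
    filter_upwards [eventually_le_atBot (0:ℝ)] with τ hτ
    have := mul_sub_le_sub_of_deriv_ge hgd hgc hτ
    simp only [zero_sub] at this; linarith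
  have hsurj : Surjective g := hgcont.surjective htop hbot
  -- the order isomorphism and homeomorphism
  set e : ℝ ≃o ℝ := hsm.orderIsoOfSurjective g hsurj with he
  set φ : ℝ ≃ₜ ℝ := e.toHomeomorph with hφ
  have hφg : ∀ τ, φ τ = g τ := fun τ => rfl
  have hφg' : (φ : ℝ → ℝ) = g := funext hφg
  refine ⟨φ.symm, ?_, fun τ => ?_, fun s => ?_, fun s s' => ?_⟩
  · -- smoothness of the inverse
    refine φ.contDiff_symm_deriv (f' := deriv g) (fun τ => by have := hgc τ; linarith) (fun τ => ?_) (by rw [hφg']; exact hg)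
    rw [hφg']; exact (hgd τ).hasDerivAt
  · exact φ.symm_apply_apply τ
  · exact φ.apply_symm_apply s
  · -- Lipschitz bound of the inverse
    have key : ∀ s s' : ℝ, φ.symm s' ≤ φ.symm s → |φ.symm s - φ.symm s'| ≤ |s - s'| / c := by
      intro s s' hle
      have h := mul_sub_le_sub_of_deriv_ge hgd hgc hle
      rw [← hφg, ← hφg, φ.apply_symm_apply, φ.apply_symm_apply] at h
      have hss : s' ≤ s := by nlinarith [mul_nonneg hc.le (sub_nonneg.2 hle)]
      rw [abs_of_nonneg (by linarith : 0 ≤ φ.symm s - φ.symm s'), le_div_iff₀ hc, abs_of_nonneg (by linarith : 0 ≤ s - s')]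
      linarith
    rcases le_total (φ.symm s') (φ.symm s) with h | h
    · exact key s s' h
    · rw [abs_sub_comm, abs_sub_comm s s']; exact key s' s h

end Summit.NavierStokesRegularity.NavierStokesRegularity.Theorems.SkeletonJ1RFrame

end
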